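import Literature.Analysis.FluidPDE.AncientLimitVanishingScaled
import Literature.Analysis.FluidPDE.LocalTypeI
import Literature.Analysis.FluidPDE.LocalTypeIReverseTools
import HarnessLib

/-!
# Line `apex-dichotomy` of `TerminalTrace.TypeITraceScarL3` (stmt-NavierStokesRegularity-18385) —
# STUB B `stub_no_confinedExtinctApex`: a CONFINED extinct Type-I apex is not singular at the origin

Route `TerminalTrace` (NavierStokesRegularity), item `TypeITraceScarL3`, registered skeleton `apex-dichotomy`
(nsreg-p2 g27, ROUND-25, sha16 95aa062ef93d7802; Stub 1 ✓ p576636, Stub 2′ ✓ p583907, Stub B here, Stub C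
`stub_no_spreadExtinctApex` = the open hard core).  Seat ns-typeII-p3 g9 (cell ns-regularity-ideate; planner's
one-taker fallback 23:18Z), `--supports stmt-NavierStokesRegularity-18385`.

An EXTINCT TYPE-I APEX `(U, P, G, M, D₀, C)` — suitable in every parabolic ball `Q(a)` at the origin, weak gradient,
`𝐈(Q(a)) ≤ M`, plain `cknD r z₀ P ≤ D₀` at every apex `z₀.1 ≤ 0`, rate `‖U(s)‖ ≤ C/√(−s)` a.e. on every slice,
weakly vanishing at the top time — which is CONFINED (`‖U‖ ≤ K` a.e. on `]−δ, 0[ × (closedBall 0 R)ᶜ` for some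
`δ > 0`, `R`, `K`) is NOT backward-singular at the origin.

Proof (the planner's recipe, ROUND-25 §Stubs; the tree's ESS endgame):

1. RESCALE by `μ = min(1, √(δ/2))`: `U_μ(s, y) = μ U(μ² s, μ y)`, `P_μ = μ² P(μ²·, μ·)`.  All hypotheses are
   scale-covariant (`IsSuitableWeakSolutionInBall.zoomOut`, `cknD_nsZoom`, the top-vanishing by dilating the test
   field as in `ancient_lintegral_cube_eq_zero_of_farField_le`, the far field by
   `quasiMeasurePreserving_parabolicDilation`), and the far-field window becomes `]−2, 0[`.
2. SLICE LIOUVILLE (`hL'` of the endgame) from the RATE and the `A`-part of `𝐈`: for a.e. `t ∈ ]−1, 0[`, an entire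
   harmonic field `V` agreeing a.e. with `U_μ(t)` is a.e.-bounded by `C/√(−t)` (hence bounded: an open null set is
   empty), hence constant coordinate-wise (`HarmonicOnNhd.apply_eq_apply_of_abs_le`), and the constant `b` has
   `‖b‖² |B_n| = ∫_{B_n} ‖U_μ(t)‖² ≤ M n` for all `n` (`cknAEss ≤ 𝐈`, essential supremum in time), so `b = 0`.
3. `ancient_lintegral_cube_eq_zero_of_farField_le` (ESS 2003 Thm 5.1 / Wang–Zhang §4 Step 3, PROVED in the tree)
   gives `∫_{Q(λ/2)} |U_μ|³ = 0`, so `U_μ = 0` a.e. there, its `L^∞` norm on that cylinder is `0`, and by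
   `eLpNorm_top_nsZoom` the origin is not a backward-singular point of `U`.

* `harmonic_eq_zero_of_ae_bounded_of_energy_growth` — step 2 as a lemma;
* **`stub_no_confinedExtinctApex`** — the registered signature verbatim.

WHAT THIS IS NOT: not NS regularity, not item 18385 — after this stub the line `apex-dichotomy` is the item modulo
EXACTLY Stub C `stub_no_spreadExtinctApex` (spread extinct apices: Type-I-large activity escaping to spatial infinity
as `s → 0⁻`), the named hard core.  [folklore; EscauriazaSereginSverak2003 Thm 5.1; Seregin2014 §6.6; WangZhang2016 §4]
-/

noncomputable section

set_option linter.dupNamespace false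

namespace Summit.NavierStokesRegularity.NavierStokesRegularity.Theorems.TypeITraceScarL3

open MeasureTheory Set Function Filter Topology TopologicalSpace Metric InnerProductSpace
open Literature.Analysis.FluidPDE
open scoped NNReal ENNReal RealInnerProductSpace Laplacian

/-! ### Slice Liouville from an a.e. bound and linear energy growth -/

/-- **An entire harmonic field which is a.e. bounded and whose ball energies grow at most linearly
vanishes.**  If `V` is harmonic on `ℝ³`, `V = f` a.e., `‖f‖ ≤ B` a.e., and `∫_{B(0,n)} ‖f‖² ≤ M n` for every
`n ≥ 1`, then `V = 0`: `V` is bounded (a null open set is empty), hence constant coordinate-wise (Liouville), and a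
non-zero constant has ball energies `≍ n³`. [folklore; GilbargTrudinger2001 Thm 2.1 and Liouville's theorem] -/
theorem harmonic_eq_zero_of_ae_bounded_of_energy_growth
    {V f : EuclideanSpace ℝ (Fin 3) → EuclideanSpace ℝ (Fin 3)}
    (hV : HarmonicOnNhd V (univ : Set (EuclideanSpace ℝ (Fin 3)))) (hVf : V =ᵐ[volume] f)
    {B : ℝ} (hB : ∀ᵐ y ∂(volume : Measure (EuclideanSpace ℝ (Fin 3))), ‖f y‖ ≤ B)
    {M : ℝ≥0∞} (hM : M ≠ ⊤)
    (hgrowth : ∀ n : ℕ, 1 ≤ n →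
      ∫⁻ y in ball (0 : EuclideanSpace ℝ (Fin 3)) n, ‖f y‖ₑ ^ 2 ≤ M * (n : ℝ≥0∞)) :
    V = 0 := by
  -- `V` is continuous and a.e. bounded, hence bounded
  have hcd : ContDiff ℝ 2 V := contDiffOn_univ.1 hV.contDiffOn
  have hVc : Continuous V := hcd.continuous
  have hVB : ∀ y, ‖V y‖ ≤ B := by
    have hae : ∀ᵐ y ∂(volume : Measure (EuclideanSpace ℝ (Fin 3))), ‖V y‖ ≤ B := by
      filter_upwards [hVf, hB] with y hy hyB
      rw [hy]; exact hyB
    have hopen : IsOpen {y : EuclideanSpace ℝ (Fin 3) | B < ‖V y‖} :=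
      isOpen_lt continuous_const hVc.norm
    have hnull : volume {y : EuclideanSpace ℝ (Fin 3) | B < ‖V y‖} = 0 := by
      have h := mem_ae_iff.1 hae
      have e : ({y : EuclideanSpace ℝ (Fin 3) | ‖V y‖ ≤ B})ᶜ = {y | B < ‖V y‖} := by
        ext y; simp only [mem_compl_iff, mem_setOf_eq, not_le]
      rwa [e] at h
    have hempty := (hopen.measure_eq_zero_iff volume).1 hnull
    intro y
    by_contra h
    have : y ∈ {y : EuclideanSpace ℝ (Fin 3) | B < ‖V y‖} := not_le.1 h
    rw [hempty] at this
    exact this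
  -- every coordinate is a bounded entire harmonic function, hence constant
  have hΔ : ∀ y, Δ V y = 0 := fun y => by
    have h := (hV y (mem_univ y)).2.eq_of_nhds
    simpa using h
  have hconst : V = fun _ => V 0 := by
    funext x
    ext i
    set η : EuclideanSpace ℝ (Fin 3) → ℝ := fun z => V z i with hη
    have hηeq : η = (EuclideanSpace.proj i : EuclideanSpace ℝ (Fin 3) →L[ℝ] ℝ) ∘ V := by
      funext z; rfl
    have hη2 : ContDiff ℝ 2 η := by
      rw [hηeq]; exact (EuclideanSpace.proj i : EuclideanSpace ℝ (Fin 3) →L[ℝ] ℝ).contDiff.comp hcd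
    have hηΔ : ∀ z, (Δ η) z = 0 := fun z => by
      rw [hηeq, hcd.contDiffAt.laplacian_CLM_comp_left, Function.comp_apply, hΔ z, map_zero]
    have hharm : HarmonicOnNhd η univ := harmonicOnNhd_of_laplacian_eq_zero hη2 hηΔ
    have hbdd : ∀ z, |η z| ≤ B := fun z => by
      have h1 : |V z i| ≤ ‖V z‖ := by simpa [Real.norm_eq_abs] using PiLp.norm_apply_le (V z) i
      exact h1.trans (hVB z)
    exact hharm.apply_eq_apply_of_abs_le hbdd x 0
  -- the constant has ball energies `‖b‖² |B_n| ≤ M n`, so it vanishes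
  set b : EuclideanSpace ℝ (Fin 3) := V 0 with hb
  have hballs : ∀ n : ℕ, 1 ≤ n →
      ‖b‖ₑ ^ 2 * volume (ball (0 : EuclideanSpace ℝ (Fin 3)) n) ≤ M * (n : ℝ≥0∞) := by
    intro n hn
    have e : ∫⁻ y in ball (0 : EuclideanSpace ℝ (Fin 3)) n, ‖f y‖ₑ ^ 2 =
        ∫⁻ y in ball (0 : EuclideanSpace ℝ (Fin 3)) n, ‖b‖ₑ ^ 2 := by
      refine lintegral_congr_ae ?_
      filter_upwards [ae_restrict_of_ae (s := ball (0 : EuclideanSpace ℝ (Fin 3)) n) hVf] with y hy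
      rw [← hy, hconst]
    have h := hgrowth n hn
    rwa [e, lintegral_const, Measure.restrict_apply_univ] at h
  -- a non-zero constant has ball energies `‖b‖² n³ |B_1|`, contradicting `≤ M n`
  suffices hb0 : b = 0 by
    rw [hconst]
    funext y
    exact hb0
  by_contra hb0
  have hbne : ‖b‖ₑ ≠ 0 := by simpa using hb0
  set c : ℝ≥0∞ := ‖b‖ₑ ^ 2 * volume (ball (0 : EuclideanSpace ℝ (Fin 3)) 1) with hc
  have hc0 : c ≠ 0 := mul_ne_zero (pow_ne_zero _ hbne) (measure_ball_pos volume _ one_pos).ne'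
  have hctop : c ≠ ⊤ := ENNReal.mul_ne_top (ENNReal.pow_ne_top enorm_ne_top) measure_ball_lt_top.ne
  have key : ∀ n : ℕ, 1 ≤ n → c * (n : ℝ≥0∞) ^ 2 ≤ M := by
    intro n hn
    have h := hballs n hn
    rw [Measure.addHaar_ball volume (0 : EuclideanSpace ℝ (Fin 3)) (Nat.cast_nonneg n),
      finrank_euclideanSpace_fin, ENNReal.ofReal_pow (Nat.cast_nonneg n), ENNReal.ofReal_natCast] at h
    have e : ‖b‖ₑ ^ 2 * ((n : ℝ≥0∞) ^ 3 * volume (ball (0 : EuclideanSpace ℝ (Fin 3)) 1)) =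
        c * (n : ℝ≥0∞) ^ 2 * (n : ℝ≥0∞) := by rw [hc]; ring
    rw [e] at h
    have hn0 : (n : ℝ≥0∞) ≠ 0 := by exact_mod_cast (show n ≠ 0 by omega)
    exact (ENNReal.mul_le_mul_iff_left hn0 (ENNReal.natCast_ne_top n)).1 h
  -- choose `n` with `M < c n ≤ c n²`
  obtain ⟨n, hn⟩ := exists_nat_gt (M.toReal / c.toReal)
  set n' : ℕ := max n 1 with hn'
  have hn'1 : 1 ≤ n' := le_max_right _ _
  have hcR : 0 < c.toReal := ENNReal.toReal_pos hc0 hctop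
  have hlt : M.toReal < c.toReal * (n' : ℝ) ^ 2 := by
    have h1 : M.toReal < c.toReal * n := by
      rw [div_lt_iff₀ hcR] at hn; linarith
    have h2 : (n : ℝ) ≤ n' := by exact_mod_cast le_max_left n 1
    have h3 : (n' : ℝ) ≤ (n' : ℝ) ^ 2 := by
      have : (1 : ℝ) ≤ n' := by exact_mod_cast hn'1
      nlinarith
    nlinarith
  have hle := key n' hn'1
  have hle' : (c * (n' : ℝ≥0∞) ^ 2).toReal ≤ M.toReal := ENNReal.toReal_mono hM hle
  rw [ENNReal.toReal_mul, ENNReal.toReal_pow, ENNReal.toReal_natCast] at hle'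
  linarith

/-! ### Stub B -/

set_option maxHeartbeats 1600000 in
/-- **STUB B of line `apex-dichotomy` (item stmt-NavierStokesRegularity-18385 `TerminalTrace.TypeITraceScarL3`),
registered signature.**  A CONFINED extinct Type-I apex is not singular at the origin (module docstring for
the proof: rescale by `μ = min(1, √(δ/2))`, slice Liouville from the rate and the `A`-part of `𝐈`, and the tree's
ESS endgame `ancient_lintegral_cube_eq_zero_of_farField_le`).
[folklore; EscauriazaSereginSverak2003 Thm 5.1; Seregin2014 §6.6; WangZhang2016 §4] -/
theorem stub_no_confinedExtinctApex :
    ∀ (U : ℝ → EuclideanSpace ℝ (Fin 3) → EuclideanSpace ℝ (Fin 3))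
      (P : ℝ → EuclideanSpace ℝ (Fin 3) → ℝ)
      (G : ℝ → EuclideanSpace ℝ (Fin 3) →
        EuclideanSpace ℝ (Fin 3) →L[ℝ] EuclideanSpace ℝ (Fin 3))
      (M D₀ : ℝ≥0) (C : ℝ),
      (∀ a : ℝ, 0 < a →
        IsSuitableWeakSolutionInBall a (0 : ℝ × EuclideanSpace ℝ (Fin 3)) U P) →
      (∀ a : ℝ, 0 < a →
        HasWeakSpatialGradientOn
          (parabolicCylinderOpens a (0 : ℝ × EuclideanSpace ℝ (Fin 3))) U G) →
      (∀ a : ℝ, 0 < a →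
        typeIBound (parabolicCylinder a (0 : ℝ × EuclideanSpace ℝ (Fin 3))) U P G ≤ M) →
      (∀ z₀ : ℝ × EuclideanSpace ℝ (Fin 3), z₀.1 ≤ 0 →
        ∀ r : ℝ, 0 < r → cknD r z₀ P ≤ D₀) →
      (∀ s : ℝ, s < 0 →
        ∀ᵐ y : EuclideanSpace ℝ (Fin 3), ‖U s y‖ ≤ C / Real.sqrt (-s)) →
      (∀ φ : EuclideanSpace ℝ (Fin 3) → EuclideanSpace ℝ (Fin 3),
        ContDiff ℝ (⊤ : ℕ∞) φ →
        HasCompactSupport φ → ∀ ε : ℝ, 0 < ε →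
        ∃ s₀ : ℝ, s₀ < 0 ∧ ∀ᵐ s ∂(volume.restrict (Ioo s₀ 0)), |∫ y, ⟪U s y, φ y⟫| ≤ ε) →
      (∃ δ : ℝ, 0 < δ ∧ ∃ R K : ℝ,
        ∀ᵐ z ∂(volume.restrict
          (Ioo (-δ) 0 ×ˢ (closedBall (0 : EuclideanSpace ℝ (Fin 3)) R)ᶜ)), ‖U z.1 z.2‖ ≤ K) →
      ¬ IsBackwardSingularPoint U (0 : ℝ × EuclideanSpace ℝ (Fin 3)) := by
  intro U P G M D₀ C hw hG hI hD hrate htop hconf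
  obtain ⟨δ, hδ, R, K, hfar⟩ := hconf
  -- ### the scale
  set μ : ℝ := min 1 (Real.sqrt (δ / 2)) with hμdef
  have hμpos : 0 < μ := lt_min one_pos (Real.sqrt_pos.2 (by positivity))
  have hμ1 : μ ≤ 1 := min_le_left _ _
  have hμ0 : μ ≠ 0 := hμpos.ne'
  have hμ2 : 0 < μ ^ 2 := pow_pos hμpos 2
  have hμδ : 2 * μ ^ 2 ≤ δ := by
    have h1 : μ ≤ Real.sqrt (δ / 2) := min_le_right _ _
    have h2 : μ ^ 2 ≤ δ / 2 := by
      have := pow_le_pow_left₀ hμpos.le h1 2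
      rwa [Real.sq_sqrt (by positivity)] at this
    linarith
  -- ### the rescaled pair
  set U' : ℝ → EuclideanSpace ℝ (Fin 3) → EuclideanSpace ℝ (Fin 3) :=
    μ • stPull (μ ^ 2) μ (0 : ℝ) (0 : EuclideanSpace ℝ (Fin 3)) U with hU'def
  set P' : ℝ → EuclideanSpace ℝ (Fin 3) → ℝ :=
    μ ^ 2 • stPull (μ ^ 2) μ (0 : ℝ) (0 : EuclideanSpace ℝ (Fin 3)) P with hP'def
  have hU'apply : ∀ s y, U' s y = μ • U (μ ^ 2 * s) (μ • y) := fun s y => by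
    rw [hU'def]; simp only [Pi.smul_apply, stPull_apply, zero_add]
  have hst0 : ∀ z : ℝ × EuclideanSpace ℝ (Fin 3),
      stAffine (μ ^ 2) μ (0 : ℝ) (0 : EuclideanSpace ℝ (Fin 3)) z = (μ ^ 2 * z.1, μ • z.2) := by
    intro z
    rw [show z = (z.1, z.2) from rfl, stAffine_apply, zero_add, zero_add]
  -- (i) suitable in every `Q(a)`
  have hw' : ∀ a : ℝ, 0 < a →
      IsSuitableWeakSolutionInBall a (0 : ℝ × EuclideanSpace ℝ (Fin 3)) U' P' := by
    intro a ha
    have h := (hw (a * μ) (mul_pos ha hμpos)).zoomOut hμpos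
    rwa [mul_div_cancel_right₀ a hμ0] at h
  -- (ii) the plain pressure bound at every apex, scale-invariant
  have hP' : ∀ z₀ : ℝ × EuclideanSpace ℝ (Fin 3), z₀.1 ≤ 0 → ∀ r ∈ Ioc (0 : ℝ) 1, cknD r z₀ P' ≤ D₀ := by
    intro z₀ hz₀ r hr
    rw [hP'def, cknD_nsZoom hμpos hr.1 0 0 z₀ P]
    refine hD _ ?_ (μ * r) (mul_pos hμpos hr.1)
    rw [hst0]
    exact mul_nonpos_of_nonneg_of_nonpos hμ2.le hz₀
  -- (iii) weak vanishing at the top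
  have htop' : ∀ φ : EuclideanSpace ℝ (Fin 3) → EuclideanSpace ℝ (Fin 3), ContDiff ℝ (⊤ : ℕ∞) φ →
      HasCompactSupport φ → ∀ ε : ℝ, 0 < ε →
        ∃ s₀ : ℝ, s₀ < 0 ∧ ∀ᵐ s ∂(volume.restrict (Ioo s₀ 0)), |∫ y, ⟪U' s y, φ y⟫| ≤ ε := by
    -- adapted from Literature/Analysis/FluidPDE/AncientLimitVanishingScaled.lean (step (iii))
    intro φ hφ hφc ε hε
    set φl : EuclideanSpace ℝ (Fin 3) → EuclideanSpace ℝ (Fin 3) := fun x => φ (μ⁻¹ • x) with hφl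
    have hφl_smooth : ContDiff ℝ (⊤ : ℕ∞) φl := hφ.comp (contDiff_const_smul _)
    have hφl_supp : HasCompactSupport φl := hφc.comp_smul (inv_ne_zero hμ0)
    obtain ⟨s₀, hs₀, hs₀ae⟩ := htop φl hφl_smooth hφl_supp (μ ^ 2 * ε) (by positivity)
    refine ⟨s₀ / μ ^ 2, div_neg_of_neg_of_pos hs₀ hμ2, ?_⟩
    have hpair : ∀ s, ∫ y, ⟪U' s y, φ y⟫ = (μ ^ 2)⁻¹ * ∫ x, ⟪U (μ ^ 2 * s) x, φl x⟫ := by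
      intro s
      have e1 : (fun y => ⟪U' s y, φ y⟫) = fun y =>
          μ * (fun x => ⟪U (μ ^ 2 * s) x, φl x⟫) (μ • y) := by
        funext y
        rw [hU'apply, real_inner_smul_left, hφl]
        dsimp only
        rw [smul_smul, inv_mul_cancel₀ hμ0, one_smul]
      rw [e1, integral_const_mul, Measure.integral_comp_smul_of_nonneg volume
        (fun x => ⟪U (μ ^ 2 * s) x, φl x⟫) μ (hR := hμpos.le), finrank_euclideanSpace_fin,
        smul_eq_mul, ← mul_assoc]
      congr 1
      field_simp
    have h1 := ae_restrict_comp_affine' measurableSet_Ioo hs₀ae (c := μ ^ 2) (d := 0) hμ2.ne'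
      (S' := Ioo (s₀ / μ ^ 2) 0) measurableSet_Ioo (fun s hs => by
        rw [zero_add]
        refine ⟨?_, mul_neg_of_pos_of_neg hμ2 hs.2⟩
        have := hs.1
        rw [div_lt_iff₀ hμ2] at this
        linarith)
    filter_upwards [h1] with s hs
    rw [zero_add] at hs
    rw [hpair, abs_mul, abs_inv, abs_of_pos hμ2]
    calc (μ ^ 2)⁻¹ * |∫ x, ⟪U (μ ^ 2 * s) x, φl x⟫| ≤ (μ ^ 2)⁻¹ * (μ ^ 2 * ε) :=
          mul_le_mul_of_nonneg_left hs (inv_nonneg.2 hμ2.le)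
      _ = ε := by field_simp
  -- (iv) the far field on the window `]−2, 0[`
  set R₁ : ℝ := max R 1 with hR₁
  have hR₁pos : 0 < R₁ := lt_of_lt_of_le one_pos (le_max_right _ _)
  have hR₀' : 0 < R₁ / μ := div_pos hR₁pos hμpos
  set L : ℝ := max (μ * K) 1 with hL
  have hLpos : 0 < L := lt_of_lt_of_le one_pos (le_max_right _ _)
  have hfar' : ∀ᵐ z ∂(volume.restrict
      (Ioo (-(2 : ℝ)) 0 ×ˢ (closedBall (0 : EuclideanSpace ℝ (Fin 3)) (R₁ / μ))ᶜ)), ‖U' z.1 z.2‖ ≤ L := by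
    -- adapted from Literature/Analysis/FluidPDE/AncientLimitVanishingScaled.lean (step (iv))
    have hSm : MeasurableSet (Ioo (-δ) (0 : ℝ) ×ˢ (closedBall (0 : EuclideanSpace ℝ (Fin 3)) R)ᶜ) :=
      measurableSet_Ioo.prod measurableSet_closedBall.compl
    have hS'm : MeasurableSet
        (Ioo (-(2 : ℝ)) 0 ×ˢ (closedBall (0 : EuclideanSpace ℝ (Fin 3)) (R₁ / μ))ᶜ) :=
      measurableSet_Ioo.prod measurableSet_closedBall.compl
    rw [ae_restrict_iff' hSm] at hfar
    rw [ae_restrict_iff' hS'm]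
    filter_upwards [(quasiMeasurePreserving_parabolicDilation hμ0).ae hfar] with z hz hzS'
    rw [mem_prod, mem_Ioo, mem_compl_iff, mem_closedBall, dist_zero_right, not_le] at hzS'
    have hmem : ((μ ^ 2 * z.1, μ • z.2) : ℝ × EuclideanSpace ℝ (Fin 3)) ∈
        Ioo (-δ) (0 : ℝ) ×ˢ (closedBall (0 : EuclideanSpace ℝ (Fin 3)) R)ᶜ := by
      refine ⟨⟨?_, mul_neg_of_pos_of_neg hμ2 hzS'.1.2⟩, ?_⟩
      · nlinarith [hzS'.1.1]
      · rw [mem_compl_iff, mem_closedBall, dist_zero_right, not_le, norm_smul, Real.norm_eq_abs,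
          abs_of_pos hμpos]
        have h1 := hzS'.2
        rw [div_lt_iff₀ hμpos] at h1
        have h2 : R ≤ R₁ := le_max_left _ _
        linarith
    have hb := hz hmem
    rw [hU'apply, norm_smul, Real.norm_eq_abs, abs_of_pos hμpos]
    calc μ * ‖U (μ ^ 2 * z.1) (μ • z.2)‖ ≤ μ * K := mul_le_mul_of_nonneg_left hb hμpos.le
      _ ≤ L := le_max_left _ _
  -- (v) the Liouville property of the slices: rate ⇒ a.e. bounded, `A`-part of `𝐈` ⇒ linear energy growth
  have hrate' : ∀ s : ℝ, s < 0 → ∀ᵐ y : EuclideanSpace ℝ (Fin 3), ‖U' s y‖ ≤ C / Real.sqrt (-s) := by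
    intro s hs
    have hs2 : μ ^ 2 * s < 0 := mul_neg_of_pos_of_neg hμ2 hs
    have h := (Measure.quasiMeasurePreserving_smul volume hμ0).ae (hrate (μ ^ 2 * s) hs2)
    filter_upwards [h] with y hy
    have hsq : Real.sqrt (-(μ ^ 2 * s)) = μ * Real.sqrt (-s) := by
      rw [show -(μ ^ 2 * s) = μ ^ 2 * (-s) by ring, Real.sqrt_mul hμ2.le, Real.sqrt_sq hμpos.le]
    have hpos : 0 < Real.sqrt (-s) := Real.sqrt_pos.2 (by linarith)
    rw [hU'apply, norm_smul, Real.norm_eq_abs, abs_of_pos hμpos]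
    have hy' : ‖U (μ ^ 2 * s) (μ • y)‖ ≤ C / (μ * Real.sqrt (-s)) := by rw [← hsq]; exact hy
    calc μ * ‖U (μ ^ 2 * s) (μ • y)‖ ≤ μ * (C / (μ * Real.sqrt (-s))) := mul_le_mul_of_nonneg_left hy' hμpos.le
      _ = C / Real.sqrt (-s) := by field_simp
  have hA' : ∀ n : ℕ, 1 ≤ n → ∀ᵐ t ∂(volume.restrict (Ioo (-1 : ℝ) 0)),
      ∫⁻ y in ball (0 : EuclideanSpace ℝ (Fin 3)) n, ‖U' t y‖ₑ ^ 2 ≤ (M : ℝ≥0∞) * (n : ℝ≥0∞) := by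
    intro n hn
    have hn0 : (0 : ℝ) < n := by exact_mod_cast hn
    have hμn : 0 < μ * n := mul_pos hμpos hn0
    -- `A(0, n; U') = A(0, μ n; U) ≤ 𝐈(Q(μ n)) ≤ M`
    have hAe : cknAEss n (0 : ℝ × EuclideanSpace ℝ (Fin 3)) U' ≤ M := by
      rw [hU'def, cknAEss_nsZoom hμpos hn0 0 0 0 U, hst0]
      simp only [Prod.fst_zero, Prod.snd_zero, mul_zero, smul_zero]
      refine le_trans ?_ (hI (μ * n) hμn)
      exact (cknAEss_le_abScaledSum (p := P) (G := G)).trans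
        (abScaledSum_le_typeIBound hμn subset_rfl)
    -- unfold the essential supremum
    have h1 : ∀ᵐ t ∂(volume.restrict (Ioo ((0 : ℝ × EuclideanSpace ℝ (Fin 3)).1 - (n : ℝ) ^ 2)
        (0 : ℝ × EuclideanSpace ℝ (Fin 3)).1)),
        (ENNReal.ofReal (n : ℝ))⁻¹ * ∫⁻ y in ball (0 : ℝ × EuclideanSpace ℝ (Fin 3)).2 n, ‖U' t y‖ₑ ^ 2 ≤ M := by
      have h := ENNReal.ae_le_essSup (μ := volume.restrict (Ioo ((0 : ℝ × EuclideanSpace ℝ (Fin 3)).1 -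
          (n : ℝ) ^ 2) (0 : ℝ × EuclideanSpace ℝ (Fin 3)).1))
        (fun t => (ENNReal.ofReal (n : ℝ))⁻¹ * ∫⁻ y in ball (0 : ℝ × EuclideanSpace ℝ (Fin 3)).2 n,
          ‖U' t y‖ₑ ^ 2)
      filter_upwards [h] with t ht
      exact ht.trans hAe
    have hsub : Ioo (-1 : ℝ) 0 ⊆ Ioo ((0 : ℝ × EuclideanSpace ℝ (Fin 3)).1 - (n : ℝ) ^ 2)
        (0 : ℝ × EuclideanSpace ℝ (Fin 3)).1 := by
      intro t ht
      simp only [Prod.fst_zero, zero_sub, mem_Ioo]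
      have : (1 : ℝ) ≤ (n : ℝ) ^ 2 := by
        have h1 : (1 : ℝ) ≤ n := by exact_mod_cast hn
        nlinarith
      exact ⟨by linarith [ht.1], ht.2⟩
    filter_upwards [ae_restrict_of_ae_restrict_of_subset hsub h1] with t ht
    rw [Prod.snd_zero] at ht
    have hn0' : ENNReal.ofReal (n : ℝ) ≠ 0 := (ENNReal.ofReal_pos.2 hn0).ne'
    have hntop : ENNReal.ofReal (n : ℝ) ≠ ⊤ := ENNReal.ofReal_ne_top
    calc ∫⁻ y in ball (0 : EuclideanSpace ℝ (Fin 3)) n, ‖U' t y‖ₑ ^ 2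
        = ENNReal.ofReal (n : ℝ) * ((ENNReal.ofReal (n : ℝ))⁻¹ *
            ∫⁻ y in ball (0 : EuclideanSpace ℝ (Fin 3)) n, ‖U' t y‖ₑ ^ 2) := by
          rw [← mul_assoc, ENNReal.mul_inv_cancel hn0' hntop, one_mul]
      _ ≤ ENNReal.ofReal (n : ℝ) * M := by gcongr
      _ = (M : ℝ≥0∞) * (n : ℝ≥0∞) := by rw [ENNReal.ofReal_natCast, mul_comm]
  have hL' : ∀ᵐ t ∂(volume.restrict (Ioo (-1 : ℝ) 0)),
      ∀ V : EuclideanSpace ℝ (Fin 3) → EuclideanSpace ℝ (Fin 3),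
        HarmonicOnNhd V (univ : Set (EuclideanSpace ℝ (Fin 3))) → V =ᵐ[volume] U' t → V = 0 := by
    have hall : ∀ᵐ t ∂(volume.restrict (Ioo (-1 : ℝ) 0)), ∀ n : ℕ, 1 ≤ n →
        ∫⁻ y in ball (0 : EuclideanSpace ℝ (Fin 3)) n, ‖U' t y‖ₑ ^ 2 ≤ (M : ℝ≥0∞) * (n : ℝ≥0∞) := by
      rw [ae_all_iff]
      intro n
      by_cases hn : 1 ≤ n
      · filter_upwards [hA' n hn] with t ht _ using ht
      · exact ae_of_all _ fun t h => absurd h hn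
    filter_upwards [hall, ae_restrict_mem measurableSet_Ioo] with t ht htI V hV hVU
    exact harmonic_eq_zero_of_ae_bounded_of_energy_growth hV hVU (hrate' t htI.2) ENNReal.coe_ne_top ht
  -- (vi) the ESS endgame for the rescaled pair
  have hzero := ancient_lintegral_cube_eq_zero_of_farField_le hw' hP' htop' hLpos hR₀' (T₁ := 2) le_rfl
    hfar' hL'
  -- ### back to `U`: the rescaled pair vanishes a.e. on `Q(λ/2)`, so the origin is not singular
  set lam : ℝ := min 1 L⁻¹ / 2 with hlamdef
  have hlampos : 0 < lam := by rw [hlamdef]; exact div_pos (lt_min one_pos (inv_pos.2 hLpos)) two_pos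
  intro hsing
  -- `U'` is backward-singular at the origin too
  have hsing' : eLpNorm (uncurry U') ⊤
      (volume.restrict (parabolicCylinder lam (0 : ℝ × EuclideanSpace ℝ (Fin 3)))) = ⊤ := by
    rw [hU'def, eLpNorm_top_nsZoom hμpos, hst0]
    simp only [Prod.fst_zero, Prod.snd_zero, mul_zero, smul_zero]
    rw [show ((0 : ℝ), (0 : EuclideanSpace ℝ (Fin 3))) = (0 : ℝ × EuclideanSpace ℝ (Fin 3)) from rfl,
      hsing (μ * lam) (mul_pos hμpos hlampos)]
    exact ENNReal.mul_top (by simpa using hμpos)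
  -- but `U' = 0` a.e. on `Q(λ/2)`
  have hmeas : AEStronglyMeasurable (uncurry U')
      (volume.restrict (parabolicCylinder lam (0 : ℝ × EuclideanSpace ℝ (Fin 3)))) := by
    have h := (hw' lam hlampos).1.distributional.1.aestronglyMeasurable
    rw [coe_parabolicCylinderOpens] at h
    exact h
  have hae0 : ∀ᵐ z ∂(volume.restrict (parabolicCylinder lam (0 : ℝ × EuclideanSpace ℝ (Fin 3)))),
      uncurry U' z = 0 := by
    have h := (lintegral_eq_zero_iff' (hmeas.enorm.pow_const 3)).1 hzero
    filter_upwards [h] with z hz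
    have hz' : ‖uncurry U' z‖ₑ ^ (3 : ℕ) = 0 := hz
    simpa using hz'
  have hnorm0 : eLpNorm (uncurry U') ⊤
      (volume.restrict (parabolicCylinder lam (0 : ℝ × EuclideanSpace ℝ (Fin 3)))) = 0 := by
    rw [eLpNorm_congr_ae hae0]
    exact eLpNorm_zero
  rw [hnorm0] at hsing'
  exact ENNReal.zero_ne_top hsing'

end Summit.NavierStokesRegularity.NavierStokesRegularity.Theorems.TypeITraceScarL3

end
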